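import Summits.AtomisticToContinuum.Crystallization.Theorems.ThreeConeCertificateSlackRigidityPricedFloorsDefs
import Summits.AtomisticToContinuum.Crystallization.Theorems.ChargedEnergyGap.Negative.BlocksBound
import Summits.AtomisticToContinuum.Crystallization.Theorems.LayeredLawsSelectHcp.Negative.PeriodicEnergy
import Summits.AtomisticToContinuum.Crystallization.Theorems.PhononSlackCertificatesPeriodicGivenLayeredLayerCake1
import Literature.MathematicalPhysics.StatisticalMechanics.HcpHomogeneous
import HarnessLib

/-!
# `SlackRigidity` (stmt-AtomisticToContinuum-11960), line `priced-floors-palm-exactification`, stub S3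
# readoff (`lms_readoff`): a fault-free equally spaced layered sample is an optimal rotated hcp sample

Lead c19, S3 energetics, last step (deterministic).  The Hägg selection in mean leaves, almost surely,
a rooted sample whose atoms form an admissible layered set `layeredSet A a s z` through the root
(`z 0 = 0`) with a FAULT-FREE word (`s (m+1) = -s m`) and EQUALLY SPACED layers (`z m = m h`), and whose
root energy is `≤ e*`.  This file reads off the conclusion of `PalmRigidity` (item 9224) for that
sample (`IsOptimalHcpSample`):

* `eq_mul_alternatingHagg`, `haggLabel_eq_mul` — a fault-free Hägg word is `± alternatingHagg` and its
  labels are `± haggLabel alternatingHagg`;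
* `layeredSet_eq_image`, `layeredSet_eq_image_neg` — hence the layered set is `A(hcpStacking a h)`
  (`s 0 = 1`) or `A(-hcpStacking a h)` (`s 0 = -1`);
* `rootEnergy_image`, `tsum_ne_eq_tsum_ne_zero`, `energyPerParticle_hcp_eq`, `rootEnergy_hcpStacking`
  — the root energy of `count|B(hcpStacking a h)` is `e(hcp a h)` for every linear isometry `B`
  (isometry invariance of Lennard-Jones sums and vertex-transitivity of hcp,
  `hcpPeriodicConfiguration_homogeneous`; `LayeredHull.cake_smul_layerNormal_one` for `h • e₃`);
* `lms_readoff` — since `e(hcp a h) ≥ e*` (`eStar_le`), `rootEnergy ≤ e*` forces `e(hcp a h) = e*`.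

All `[folklore]` bookkeeping over landed lemmas; registered sub-goal `lms_readoff`.
-/

noncomputable section

open MeasureTheory Set
open scoped BigOperators

namespace Summit.AtomisticToContinuum.Crystallization.Theorems.SlackRigidityPricedFloorsReadoff

open Literature.Probability.Process
open Literature.MathematicalPhysics.StatisticalMechanics
open Summit.AtomisticToContinuum.Crystallization.Theorems.MinimiserShells.Negative.LoadBearing (eStar)
open Summit.AtomisticToContinuum.Crystallization.Theorems.SlackRigidityPricedFloors
open Summit.AtomisticToContinuum.Crystallization.Theorems.LayeredLawsSelectHcp.Negative.PeriodicPalmLaw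
  (map_count_restrict_image countable_points view viewMeasure)
open Summit.AtomisticToContinuum.Crystallization.Theorems.LayeredLawsSelectHcp.Negative.PeriodicEnergy
  (integral_lennardJones_viewMeasure tsum_points_eq_tsum_ne)
open Summit.AtomisticToContinuum.Crystallization.Theorems.LayeredHull (cake_smul_layerNormal_one)

/-! ## Fault-free Hägg words are `± alternatingHagg` -/

/-- A fault-free Hägg word is `s 0 · alternatingHagg`. [folklore] -/
theorem eq_mul_alternatingHagg (s : ℤ → ℤ) (hs : ∀ m : ℤ, s (m + 1) = -s m) (m : ℤ) :
    s m = s 0 * alternatingHagg m := by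
  induction m using Int.induction_on with
  | zero => simp [alternatingHagg]
  | succ n ih =>
    rw [hs, ih]
    by_cases hn : Even (n : ℤ)
    · have hn' : ¬ Even ((n : ℤ) + 1) := by simpa [Int.even_add_one] using hn
      simp [alternatingHagg, hn, hn']
    · have hn' : Even ((n : ℤ) + 1) := by simpa [Int.even_add_one] using hn
      simp [alternatingHagg, hn, hn']
  | pred n ih =>
    have h1 := hs (-(n : ℤ) - 1)
    rw [sub_add_cancel] at h1
    have h2 : s (-(n : ℤ) - 1) = -s (-(n : ℤ)) := by rw [h1, neg_neg]
    rw [h2, ih]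
    by_cases hn : Even (-(n : ℤ))
    · have hn' : ¬ Even (-(n : ℤ) - 1) := by simpa [Int.even_sub_one] using hn
      simp [alternatingHagg, hn, hn']
    · have hn' : Even (-(n : ℤ) - 1) := by simpa [Int.even_sub_one] using hn
      simp [alternatingHagg, hn, hn']

/-- The labels of a fault-free Hägg word are `s 0 · haggLabel alternatingHagg`. [folklore] -/
theorem haggLabel_eq_mul (s : ℤ → ℤ) (hs : ∀ m : ℤ, s (m + 1) = -s m) (m : ℤ) :
    haggLabel s m = s 0 * haggLabel alternatingHagg m := by
  induction m using Int.induction_on with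
  | zero => simp
  | succ n ih => rw [haggLabel_succ, haggLabel_succ, ih, eq_mul_alternatingHagg s hs (n : ℤ)]; ring
  | pred n ih =>
    have h1 := haggLabel_succ s (-(n : ℤ) - 1)
    have h2 := haggLabel_succ alternatingHagg (-(n : ℤ) - 1)
    rw [sub_add_cancel] at h1 h2
    have h3 := eq_mul_alternatingHagg s hs (-(n : ℤ) - 1)
    linear_combination -h1 + ih - h3 + s 0 * h2

/-! ## The layered set of a fault-free equally spaced layering is a rotated `± hcpStacking` -/

/-- Pattern points for labels `= haggLabel alternatingHagg` and heights `m h` are the points of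
`hcpStacking a h`. [folklore] -/
theorem patternPoint_eq {s : ℤ → ℤ} {z : ℤ → ℝ} (a h : ℝ)
    (hL : ∀ m : ℤ, haggLabel s m = haggLabel alternatingHagg m) (hz : ∀ m : ℤ, z m = m * h)
    (m i j : ℤ) :
    ((i : ℝ) • triangularVec₁ a) + ((j : ℝ) • triangularVec₂ a) +
        ((haggLabel s m : ℝ) • barlowOffset a) + (z m • layerNormal 1) =
      barlowPos a h alternatingHagg m i j := by
  rw [barlowPos, hL, hz, mul_smul, cake_smul_layerNormal_one]

/-- Pattern points for labels `= -haggLabel alternatingHagg` and heights `m h` are the NEGATIVES of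
points of `hcpStacking a h` (layer `-m`, in-plane indices `(-i, -j)`). [folklore] -/
theorem patternPoint_eq_neg {s : ℤ → ℤ} {z : ℤ → ℝ} (a h : ℝ)
    (hL : ∀ m : ℤ, haggLabel s m = -haggLabel alternatingHagg m) (hz : ∀ m : ℤ, z m = m * h)
    (m i j : ℤ) :
    ((i : ℝ) • triangularVec₁ a) + ((j : ℝ) • triangularVec₂ a) +
        ((haggLabel s m : ℝ) • barlowOffset a) + (z m • layerNormal 1) =
      -barlowPos a h alternatingHagg (-m) (-i) (-j) := by
  have hev : haggLabel alternatingHagg (-m) = haggLabel alternatingHagg m := by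
    simp only [haggLabel_alternating, even_neg]
  rw [barlowPos, hev, hL, hz, ← cake_smul_layerNormal_one h]
  push_cast
  module

/-- **Case `s 0 = 1`**: the layered set is `A(hcpStacking a h)`. [folklore] -/
theorem layeredSet_eq_image (A : E3 →ₗᵢ[ℝ] E3) {a h : ℝ} {s : ℤ → ℤ} {z : ℤ → ℝ}
    (hL : ∀ m : ℤ, haggLabel s m = haggLabel alternatingHagg m) (hz : ∀ m : ℤ, z m = m * h) :
    layeredSet A a s z = A '' hcpStacking a h := by
  ext p
  constructor
  · rintro ⟨m, i, j, rfl⟩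
    exact ⟨_, ⟨m, i, j, rfl⟩, by rw [patternPoint_eq a h hL hz]⟩
  · rintro ⟨_, ⟨k, i, j, rfl⟩, rfl⟩
    exact ⟨k, i, j, by rw [patternPoint_eq a h hL hz]⟩

/-- **Case `s 0 = -1`**: the layered set is `A(-hcpStacking a h)`. [folklore] -/
theorem layeredSet_eq_image_neg (A : E3 →ₗᵢ[ℝ] E3) {a h : ℝ} {s : ℤ → ℤ} {z : ℤ → ℝ}
    (hL : ∀ m : ℤ, haggLabel s m = -haggLabel alternatingHagg m) (hz : ∀ m : ℤ, z m = m * h) :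
    layeredSet A a s z = (fun x => A (-x)) '' hcpStacking a h := by
  ext p
  constructor
  · rintro ⟨m, i, j, rfl⟩
    exact ⟨_, ⟨-m, -i, -j, rfl⟩, by simp only; rw [patternPoint_eq_neg a h hL hz]⟩
  · rintro ⟨_, ⟨k, i, j, rfl⟩, rfl⟩
    refine ⟨-k, -i, -j, ?_⟩
    rw [patternPoint_eq_neg a h hL hz, neg_neg, neg_neg, neg_neg]

/-! ## The root energy of a rotated hcp sample is `e(hcp a h)` -/

/-- **Isometry invariance**: the root energy of `count|B(S)` equals that of `count|S` for a linear
isometry `B` and countable `S`. [folklore] -/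
theorem rootEnergy_image (B : E3 ≃ₗᵢ[ℝ] E3) {S : Set E3} (hS : S.Countable) :
    rootEnergy lennardJones ((Measure.count : Measure E3).restrict (B '' S)) =
      rootEnergy lennardJones ((Measure.count : Measure E3).restrict S) := by
  have he : (B : E3 → E3) = ⇑(B.toHomeomorph.toMeasurableEquiv) := by
    rw [Homeomorph.toMeasurableEquiv_coe, LinearIsometryEquiv.coe_toHomeomorph]
  rw [rootEnergy_def, rootEnergy_def, he, ← map_count_restrict_image _ hS, integral_map_equiv]
  congr 1
  refine integral_congr_ae (Filter.Eventually.of_forall fun x => ?_)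
  simp only [Homeomorph.toMeasurableEquiv_coe, LinearIsometryEquiv.coe_toHomeomorph,
    LinearIsometryEquiv.norm_map]

section Hcp

variable {a h : ℝ} (ha : a ≠ 0) (hh : h ≠ 0)

/-- The origin is a point of the hcp configuration (`barlowPos 0 0 0 = 0`). [folklore] -/
theorem zero_mem_hcp_points : (0 : E3) ∈ (hcpPeriodicConfiguration ha hh).points := by
  rw [hcpPeriodicConfiguration_points]
  exact ⟨0, 0, 0, by simp [barlowPos]⟩

/-- **Vertex-transitivity of the Lennard-Jones site sums of hcp**: the punctured lattice sum seen
from any point `x` of hcp equals the one seen from the origin (transport by the isometry of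
`hcpPeriodicConfiguration_homogeneous`). [folklore] -/
theorem tsum_ne_eq_tsum_ne_zero {x : E3} (hx : x ∈ (hcpPeriodicConfiguration ha hh).points) :
    ∑' y : {y : E3 // y ∈ (hcpPeriodicConfiguration ha hh).points ∧ y ≠ x},
        lennardJones (dist x y.1) =
      ∑' y : {y : E3 // y ∈ (hcpPeriodicConfiguration ha hh).points ∧ y ≠ 0},
        lennardJones (dist 0 y.1) := by
  set P := (hcpPeriodicConfiguration ha hh).points with hP
  obtain ⟨B, hB⟩ := hcpPeriodicConfiguration_homogeneous a h ha hh hx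
  let e : {y : E3 // y ∈ P ∧ y ≠ 0} ≃ {y : E3 // y ∈ P ∧ y ≠ x} :=
    { toFun := fun q => ⟨x + B q.1, (hB q.1).1 q.2.1, fun hq => q.2.2 (by
        have : B q.1 = 0 := by simpa using hq
        exact (B.map_eq_zero_iff).1 this)⟩
      invFun := fun y => ⟨B.symm (y.1 - x), by
        have h1 := (hB (B.symm (y.1 - x))).2
        rw [B.apply_symm_apply, add_sub_cancel] at h1
        exact h1 y.2.1, fun hy => y.2.2 (sub_eq_zero.1 ((B.symm.map_eq_zero_iff).1 hy))⟩
      left_inv := fun q => by simp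
      right_inv := fun y => by simp }
  rw [← Equiv.tsum_eq e]
  refine tsum_congr fun q => ?_
  change lennardJones (dist x (x + B q.1)) = lennardJones (dist 0 q.1)
  rw [dist_self_add_right, dist_zero_left, LinearIsometryEquiv.norm_map]

/-- Hence `e(hcp a h)` is half the punctured Lennard-Jones sum seen from the origin. [folklore] -/
theorem energyPerParticle_hcp_eq :
    (hcpPeriodicConfiguration ha hh).energyPerParticle lennardJones =
      (∑' y : {y : E3 // y ∈ (hcpPeriodicConfiguration ha hh).points ∧ y ≠ 0},
        lennardJones (dist 0 y.1)) / 2 := by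
  unfold PeriodicConfiguration.energyPerParticle
  rw [Finset.sum_congr rfl fun x hx => tsum_ne_eq_tsum_ne_zero ha hh
    ((hcpPeriodicConfiguration ha hh).mem_points_of_mem_motif hx), Finset.sum_const, nsmul_eq_mul]
  have hc : ((hcpPeriodicConfiguration ha hh).motif.card : ℝ) ≠ 0 := by
    exact_mod_cast (hcpPeriodicConfiguration ha hh).motif_nonempty.card_pos.ne'
  field_simp

/-- **The root energy of `count|hcpStacking a h` is `e(hcp a h)`.** [folklore] -/
theorem rootEnergy_hcpStacking :
    rootEnergy lennardJones ((Measure.count : Measure E3).restrict (hcpStacking a h)) =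
      (hcpPeriodicConfiguration ha hh).energyPerParticle lennardJones := by
  set Q := hcpPeriodicConfiguration ha hh with hQ
  have h0 : (0 : E3) ∈ Q.points := zero_mem_hcp_points ha hh
  have hv : viewMeasure Q 0 = (Measure.count : Measure E3).restrict (hcpStacking a h) := by
    simp only [viewMeasure, view, sub_zero, Set.image_id', hQ, hcpPeriodicConfiguration_points]
  rw [rootEnergy_def, ← hv, integral_lennardJones_viewMeasure Q h0, tsum_points_eq_tsum_ne Q h0,
    energyPerParticle_hcp_eq ha hh]

/-- … and so is the root energy of every rotated copy `count|B(hcpStacking a h)`. [folklore] -/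
theorem rootEnergy_image_hcpStacking (B : E3 ≃ₗᵢ[ℝ] E3) :
    rootEnergy lennardJones ((Measure.count : Measure E3).restrict (B '' hcpStacking a h)) =
      (hcpPeriodicConfiguration ha hh).energyPerParticle lennardJones := by
  have hc : (hcpStacking a h).Countable := by
    rw [← hcpPeriodicConfiguration_points ha hh]
    exact countable_points _
  rw [rootEnergy_image B hc, rootEnergy_hcpStacking ha hh]

end Hcp

/-- **Readoff for a rotated hcp sample**: if `S = B(hcpStacking a h)` with `(a, h) ∈ [1/2, 2]²` and
the root energy of `count|S` is `≤ e*`, then `e(hcp a h) = e*` and `count|S` is an optimal hcp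
sample. [folklore] -/
theorem isOptimalHcpSample_of_eq_image {a h : ℝ} (ha : a ≠ 0) (hh : h ≠ 0) (ha1 : 1 / 2 ≤ a)
    (ha2 : a ≤ 2) (hh1 : 1 / 2 ≤ h) (hh2 : h ≤ 2) (B : E3 ≃ₗᵢ[ℝ] E3) {S : Set E3}
    (hS : S = B '' hcpStacking a h)
    (hE : rootEnergy lennardJones ((Measure.count : Measure E3).restrict S) ≤ eStar) :
    IsOptimalHcpSample ((Measure.count : Measure E3).restrict S) := by
  subst hS
  rw [rootEnergy_image_hcpStacking ha hh] at hE
  have hge : eStar ≤ (hcpPeriodicConfiguration ha hh).energyPerParticle lennardJones :=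
    ChargedEnergyGapNegative.eStar_le _
  exact ⟨a, h, ha, hh, ha1, ha2, hh1, hh2, B, le_antisymm hE hge, rfl⟩


/-! ## The registered sub-goal -/

/-- **S3 readoff** (registered sub-goal `lms_readoff`).  A fault-free (`s (m+1) = -s m`), equally
spaced (`z m = m h`) admissible layered set through the root is a rotated `hcpStacking a h` — by `A`
if `s 0 = 1`, by `A ∘ (-id)` if `s 0 = -1` — with `(a, h) ∈ [47/50, 1] × [39a/50, 17a/20] ⊆ [1/2, 2]²`;
its root energy is `e(hcp a h) ≥ e*` (vertex-transitivity of hcp, isometry invariance of the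
Lennard-Jones sums, `eStar_le`), so `rootEnergy ≤ e*` forces `e(hcp a h) = e*`: the sample is an
optimal hcp sample. [folklore] -/
theorem lms_readoff : ∀ (A : E3 →ₗᵢ[ℝ] E3) (a h : ℝ) (s : ℤ → ℤ) (z : ℤ → ℝ), IsAdmissibleLayering a s z → z 0 = 0 → (∀ m : ℤ, s (m + 1) = -s m) → (∀ m : ℤ, z m = m * h) → rootEnergy lennardJones ((Measure.count : Measure E3).restrict (layeredSet A a s z)) ≤ eStar → IsOptimalHcpSample ((Measure.count : Measure E3).restrict (layeredSet A a s z)) := by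
  intro A a h s z hadm _ hs hz hE
  obtain ⟨ha0, ha1, hhs, hgap⟩ := hadm
  have h1 := hgap 0
  rw [zero_add, hz 1, hz 0] at h1
  push_cast at h1
  rw [one_mul, zero_mul, sub_zero] at h1
  have ha : a ≠ 0 := by intro h0; rw [h0] at ha0; norm_num at ha0
  have hh : h ≠ 0 := by intro h0; rw [h0] at h1; linarith [h1.1]
  have hb1 : (1 : ℝ) / 2 ≤ a := by linarith
  have hb2 : a ≤ 2 := by linarith
  have hb3 : (1 : ℝ) / 2 ≤ h := by linarith [h1.1]
  have hb4 : h ≤ 2 := by linarith [h1.2]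
  set A' : E3 ≃ₗᵢ[ℝ] E3 := A.toLinearIsometryEquiv rfl with hA'
  have hcoe : (A' : E3 → E3) = A := LinearIsometry.coe_toLinearIsometryEquiv A rfl
  have hL := haggLabel_eq_mul s hs
  rcases hhs 0 with h0 | h0
  · -- `s = alternatingHagg`: the layered set is `A(hcp)`
    have hL' : ∀ m : ℤ, haggLabel s m = haggLabel alternatingHagg m := fun m => by
      rw [hL m, h0, one_mul]
    have hset : layeredSet A a s z = A' '' hcpStacking a h := by
      rw [layeredSet_eq_image A hL' hz, hcoe]
    exact isOptimalHcpSample_of_eq_image ha hh hb1 hb2 hb3 hb4 A' hset hE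
  · -- `s = -alternatingHagg`: the layered set is `A(-hcp)`
    have hL' : ∀ m : ℤ, haggLabel s m = -haggLabel alternatingHagg m := fun m => by
      rw [hL m, h0, neg_one_mul]
    have hset : layeredSet A a s z =
        ((LinearIsometryEquiv.neg ℝ).trans A') '' hcpStacking a h := by
      rw [layeredSet_eq_image_neg A hL' hz, LinearIsometryEquiv.coe_trans, hcoe,
        LinearIsometryEquiv.coe_neg]
      rfl
    exact isOptimalHcpSample_of_eq_image ha hh hb1 hb2 hb3 hb4 _ hset hE

end Summit.AtomisticToContinuum.Crystallization.Theorems.SlackRigidityPricedFloorsReadoff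

end
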